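import Summits.BirchSwinnertonDyer.BirchSwinnertonDyer.Theorems.SchneiderFreeAdditiveX3JointLowerTransport
import Summits.BirchSwinnertonDyer.Rank1Residual.X11b.Three.TamagawaTwistOdd
import Summits.BirchSwinnertonDyer.Rank1Residual.X11b.BDPRouteUpperField
import HarnessLib

/-!
# The tame road's Gross–Zagier bookkeeping, III: the Tamagawa inequality `ord_p ∏c(E) ≤ ord_p ∏c(E^{(d_K)})`
# along the twist by a field in which every conductor prime SPLITS or is NON-SPLIT MULTIPLICATIVE, odd `p`
# (helper toward crux `AdditiveBranchIMC.GordTwoRankZeroOffCaseOne`, stmt-BirchSwinnertonDyer-19357, line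
# `three_field_road`, stub `stub_tameJointLowerR0`; sibling `WanTameBdpRoad.stub_jointLowerOfIndexBound`, 19358)

HONEST FRAMING. Two theorems; no definition; no named fact; no `sorry`; nothing about any curve is asserted
and BSD is proved for no curve. LEAD `cruxlead-stmt-BirchSwinnertonDyer-19357` (gen 4), `--supports
stmt-BirchSwinnertonDyer-19357`.

WHAT. The sister route's transport `SchneiderFree.padicValNat_tamagawaProduct_le_twist_of_heegner`
(`Theorems/SchneiderFreeAdditiveX3JointLowerTransport.lean` (β): at `ℓ ∣ N` the Heegner hypothesis makes `d_K`
a square in `ℚ_ℓ`, so `c_ℓ(E^{(d_K)}) = c_ℓ(E)`; at `ℓ ∤ N`, `c_ℓ(E) = 1`) assumes EVERY prime of the conductor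
split in `K`. On the tame road (`TameRoadField`: a Wan prime `q ∥ N`, NON-SPLIT multiplicative, is RAMIFIED in
`K`; every other conductor prime splits) the ramified prime is handled by Tate's algorithm instead: at a
non-split multiplicative prime `c_q(E) ∈ {1, 2}` (Silverman *ATAEC* IV.9.4 Step 2; tree
`X11b.padicValNat_localTamagawaNumber_eq_zero_of_mult_of_not_split`), so `ord_p c_q(E) = 0 ≤ ord_p c_q(E^{(d_K)})`
for every ODD `p`, whatever the (additive, `I*_n`) fibre of the twist. Hypothesis shape = Cai–Shu–Tian's
Heegner condition (1)–(2) for `c = 1`, `χ = 1` with the split alternative in local form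
(`((ℓ).primesOver 𝓞_K).ncard = 2`). The EQUALITY (Jetchev–Skinner–Wan (eq:tamK)) is not needed by the joint
lower half and is not claimed.

References: [JetchevSkinnerWan2017] §7.3.1 (eq:tamK), §7.4.1 (pp. 29–31 of arXiv:1512.06894);
[SilvermanATAEC1994] IV.9.4 Step 2, Cor. IV.9.2 (d); [SilvermanAEC2009] X.5 Cor. 5.4; [CaiShuTian2014] §1 (p. 2524).
presearch: n/a (kernel bookkeeping over tree theorems).
-/

noncomputable section

open scoped Classical

open WeierstrassCurve NumberField IsDedekindDomain Rat.HeightOneSpectrum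
  Literature.NumberTheory.EllipticCurves
  Literature.NumberTheory.EllipticCurves.Rank1Residual
  Summit.BirchSwinnertonDyer.Rank1Residual

-- D-0017: single-problem summit, so `Summit.BirchSwinnertonDyer.BirchSwinnertonDyer.…` repeats a namespace BY DESIGN.
set_option linter.dupNamespace false

namespace Summit.BirchSwinnertonDyer.BirchSwinnertonDyer.Theorems.TameJointLower

/-- `ord_p` of a finite product of non-zero naturals is the sum of the `ord_p`. [folklore] -/
private theorem padicValNat_finset_prod_aux' (p : ℕ) [Fact p.Prime] {ι : Type*} (s : Finset ι)
    (f : ι → ℕ) (hf : ∀ i ∈ s, f i ≠ 0) :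
    padicValNat p (∏ i ∈ s, f i) = ∑ i ∈ s, padicValNat p (f i) := by
  induction s using Finset.induction_on with
  | empty => simp
  | insert a s ha ih =>
    rw [Finset.prod_insert ha, Finset.sum_insert ha,
      padicValNat.mul (hf a (Finset.mem_insert_self a s))
        (Finset.prod_ne_zero_iff.mpr fun i hi => hf i (Finset.mem_insert_of_mem hi)),
      ih fun i hi => hf i (Finset.mem_insert_of_mem hi)]

/-- **`ord_p c_ℓ(E) ≤ ord_p c_ℓ(E^{(d_K)})` at every prime `ℓ`, for every ODD prime `p`**, when `K` is
quadratic and every prime `ℓ` of the conductor of the globally minimal `W` either SPLITS in `K` (two primes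
of `𝓞_K` above `ℓ`: then `d_K ∈ (ℚ_ℓ^×)²`, the two curves are `ℚ_ℓ`-isomorphic and `c_ℓ(Wd) = c_ℓ(W)`) or is a
prime of NON-SPLIT MULTIPLICATIVE reduction (then `c_ℓ(W) ∈ {1, 2}`, Tate's algorithm Step 2, so
`ord_p c_ℓ(W) = 0`); at `ℓ ∤ N`, `c_ℓ(W) = 1`. `Wd = Cd • W^{(d_K)}` is any equation of the twist.
[cite: SilvermanATAEC1994, IV.9.4 Step 2 (PDF p. 344)] [cite: SilvermanAEC2009, X.5 Cor. 5.4]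
[cite: JetchevSkinnerWan2017, §7.3.1 (eq:tamK)] -/
theorem padicValNat_localTamagawaNumber_le_twist_of_split_or_nonsplit (W : WeierstrassCurve ℚ)
    [W.IsElliptic] [W.IsGloballyMinimal] (p : ℕ) [Fact p.Prime] (hp2 : p ≠ 2)
    (K : Type) [Field K] [NumberField K] (h2 : Module.finrank ℚ K = 2)
    (hH : ∀ (ℓ : ℕ) [Fact ℓ.Prime], ℓ ∣ W.conductorNorm ℤ →
      ((Ideal.span {(ℓ : ℤ)}).primesOver (𝓞 K)).ncard = 2 ∨
        (W.HasMultiplicativeReductionAtPrime ℓ ∧ ¬ W.HasSplitMultiplicativeReductionAtPrime ℓ))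
    {Wd : WeierstrassCurve ℚ} [Wd.IsElliptic] (Cd : VariableChange ℚ)
    (hWd : Cd • W.quadraticTwist (NumberField.discr K : ℚ) = Wd) (ℓ : ℕ) [Fact ℓ.Prime] :
    padicValNat p ((W.baseChange ℚ_[ℓ]).localTamagawaNumber ℤ_[ℓ]) ≤
      padicValNat p ((Wd.baseChange ℚ_[ℓ]).localTamagawaNumber ℤ_[ℓ]) := by
  set d : ℤ := NumberField.discr K with hd_def
  have hdZ : d ≠ 0 := NumberField.discr_ne_zero K
  have hD0 : (d : ℚ) ≠ 0 := by exact_mod_cast hdZ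
  haveI : (W.baseChange ℚ_[ℓ]).IsElliptic :=
    inferInstanceAs (W.map (algebraMap ℚ ℚ_[ℓ])).IsElliptic
  haveI : (Wd.baseChange ℚ_[ℓ]).IsElliptic :=
    inferInstanceAs (Wd.map (algebraMap ℚ ℚ_[ℓ])).IsElliptic
  haveI : (W.quadraticTwist (d : ℚ)).IsElliptic := W.isElliptic_quadraticTwist hD0
  by_cases hℓN : ℓ ∣ W.conductorNorm ℤ
  · rcases hH ℓ hℓN with hsplit | ⟨hmult, hns⟩
    · -- `ℓ` splits in `K`: `d_K` is a square in `ℚ_ℓ`, the two curves are `ℚ_ℓ`-isomorphic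
      obtain ⟨θ, hθ⟩ := X11b.isSquare_discr_padic_of_ncard_eq_two h2 ℓ hsplit
      have hθ0 : θ ≠ 0 := by
        rintro rfl
        exact (map_ne_zero (algebraMap ℚ ℚ_[ℓ])).mpr hD0 (hθ.trans (mul_zero 0))
      obtain ⟨C, hC⟩ := (W.baseChange ℚ_[ℓ]).exists_variableChange_smul_eq_quadraticTwist_sq hθ0
      have h1 : (W.quadraticTwist (d : ℚ)).baseChange ℚ_[ℓ] = C • W.baseChange ℚ_[ℓ] := by
        rw [hC, baseChange, baseChange, map_quadraticTwist, hθ, sq]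
      have hYX : Wd.baseChange ℚ_[ℓ] = (Cd.map (algebraMap ℚ ℚ_[ℓ]) * C) • W.baseChange ℚ_[ℓ] := by
        rw [← hWd, WeierstrassCurve.VariableChange.baseChange_smul_eq (W.quadraticTwist (d : ℚ)) Cd ℚ_[ℓ],
          h1, mul_smul]
      rw [hYX, localTamagawaNumber_variableChange_holds ℤ_[ℓ] (W.baseChange ℚ_[ℓ])
        (Cd.map (algebraMap ℚ ℚ_[ℓ]) * C)]
    · -- `ℓ` is a NON-SPLIT multiplicative prime: `c_ℓ(W) ∈ {1, 2}` is prime to the odd `p`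
      rw [X11b.padicValNat_localTamagawaNumber_eq_zero_of_mult_of_not_split W ℓ p hp2 hmult hns]
      exact Nat.zero_le _
  · -- `ℓ ∤ N`: `W` is good at `ℓ`, `c_ℓ(W) = 1`
    have hgood : W.HasGoodReductionAtPrime ℓ := by
      by_contra h
      exact hℓN ((W.dvd_conductorNorm_iff_not_hasGoodReductionAtPrime ℓ).mpr h)
    have hcW : (W.baseChange ℚ_[ℓ]).localTamagawaNumber ℤ_[ℓ] = 1 := by
      haveI : ((W.baseChange ℚ_[ℓ]).minimal ℤ_[ℓ]).HasGoodReduction ℤ_[ℓ] := hgood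
      exact localTamagawaNumber_eq_one_of_hasGoodReduction_holds ℤ_[ℓ] _
    rw [hcW, padicValNat_one_right]
    exact Nat.zero_le _

/-- **The Tamagawa inequality `ord_p ∏_ℓ c_ℓ(E) ≤ ord_p ∏_ℓ c_ℓ(E^{(d_K)})` for every ODD prime `p`** along
the twist by a quadratic field `K` in which every conductor prime of the globally minimal `W` splits or is
non-split multiplicative (the shape of the tame-road field: a Wan prime ramified, the rest split; also the
shape of Cai–Shu–Tian's Heegner condition (1)–(2) with the split alternative in local form), for ANY equation
`Wd = Cd • W^{(d_K)}` of the twist. Both Tamagawa products are finite products of local Tamagawa numbers over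
the union of the bad places (`tamagawaProduct_eq_prod`), compared prime by prime
(`padicValNat_localTamagawaNumber_le_twist_of_split_or_nonsplit`). The sister route's all-split case is
`SchneiderFree.padicValNat_tamagawaProduct_le_twist_of_heegner` (any `p`).
[cite: JetchevSkinnerWan2017, §7.3.1 (eq:tamK) and §7.4.1 (pp. 29–31)] [cite: SilvermanATAEC1994, IV.9.4 Step 2] -/
theorem padicValNat_tamagawaProduct_le_twist_of_split_or_nonsplit (W : WeierstrassCurve ℚ)
    [W.IsElliptic] [W.IsGloballyMinimal] (p : ℕ) [Fact p.Prime] (hp2 : p ≠ 2)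
    (K : Type) [Field K] [NumberField K] (h2 : Module.finrank ℚ K = 2)
    (hH : ∀ (ℓ : ℕ) [Fact ℓ.Prime], ℓ ∣ W.conductorNorm ℤ →
      ((Ideal.span {(ℓ : ℤ)}).primesOver (𝓞 K)).ncard = 2 ∨
        (W.HasMultiplicativeReductionAtPrime ℓ ∧ ¬ W.HasSplitMultiplicativeReductionAtPrime ℓ))
    {Wd : WeierstrassCurve ℚ} [Wd.IsElliptic] (Cd : VariableChange ℚ)
    (hWd : Cd • W.quadraticTwist (NumberField.discr K : ℚ) = Wd) :
    padicValNat p W.tamagawaProduct ≤ padicValNat p Wd.tamagawaProduct := by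
  have hfW : (W.badPlaces ℤ).Finite := W.finite_badPlaces_holds ℤ
  have hfWd : (Wd.badPlaces ℤ).Finite := Wd.finite_badPlaces_holds ℤ
  set s : Finset (IsDedekindDomain.HeightOneSpectrum ℤ) := hfW.toFinset ∪ hfWd.toFinset with hs
  have hsW : ∀ v, ¬ W.HasGoodReductionAt v → v ∈ s := fun v hv ↦
    Finset.mem_union_left _ (by rw [Set.Finite.mem_toFinset, mem_badPlaces_iff]; exact hv)
  have hsWd : ∀ v, ¬ Wd.HasGoodReductionAt v → v ∈ s := fun v hv ↦
    Finset.mem_union_right _ (by rw [Set.Finite.mem_toFinset, mem_badPlaces_iff]; exact hv)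
  rw [tamagawaProduct_eq_prod W s hsW, tamagawaProduct_eq_prod Wd s hsWd,
    padicValNat_finset_prod_aux' p s _ fun v _ ↦ ?_, padicValNat_finset_prod_aux' p s _ fun v _ ↦ ?_]
  · refine Finset.sum_le_sum fun v _ ↦ ?_
    haveI := Fact.mk (primesEquiv v).2
    exact padicValNat_localTamagawaNumber_le_twist_of_split_or_nonsplit W p hp2 K h2 hH Cd hWd
      (primesEquiv v)
  · haveI := Fact.mk (primesEquiv v).2
    haveI : (Wd.baseChange ℚ_[primesEquiv v]).IsElliptic :=
      inferInstanceAs (Wd.map (algebraMap ℚ ℚ_[primesEquiv v])).IsElliptic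
    exact localTamagawaNumber_padic_ne_zero_holds (primesEquiv v) _
  · haveI := Fact.mk (primesEquiv v).2
    haveI : (W.baseChange ℚ_[primesEquiv v]).IsElliptic :=
      inferInstanceAs (W.map (algebraMap ℚ ℚ_[primesEquiv v])).IsElliptic
    exact localTamagawaNumber_padic_ne_zero_holds (primesEquiv v) _

end Summit.BirchSwinnertonDyer.BirchSwinnertonDyer.Theorems.TameJointLower

end
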